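import Literature.AlgebraicGeometry.HodgeTheory.HardLefschetzHodgeRiemannOfAnisotropy
import Literature.AlgebraicGeometry.HodgeTheory.HodgeRiemannPrimitiveClasses
import Literature.AlgebraicGeometry.HodgeTheory.KaehlerClass
import Literature.AlgebraicGeometry.HodgeTheory.HodgeTypeConjugation
import Literature.AlgebraicGeometry.HodgeTheory.HodgeModelConnected
import HarnessLib

/-!
# The Kähler package `hardLefschetz_hodgeRiemann d X` holds (discharge of the named fact)

Family `hodge`, layer `Literature/AlgebraicGeometry/HodgeTheory`. Theorems-only companion (no definition,
no named fact; D-0026) of `HardLefschetzHodgeRiemann` (the named fact `hardLefschetz_hodgeRiemann d X`: for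
`X` smooth projective of dimension `d` a hard Lefschetz datum `Λ : HardLefschetzNFold d X` whose class has
the sign-free HODGE–RIEMANN ANISOTROPY on rational primitive `(m,m)`-classes — Voisin I Thm. 6.25,
Rem. 6.27, Thm. 6.32, §7.1.2, Thm. 7.10), of `HardLefschetzHodgeRiemannOfAnisotropy` (its reduction
`hardLefschetz_hodgeRiemann_of_anisotropy` to the anisotropy of the hyperplane-type classes alone, hard
Lefschetz being the theorem `nonempty_hardLefschetzNFold_holds`) and of `HodgeRiemannPrimitiveClasses`
(`hodgeRiemann_primitiveClass`: Voisin I Thm. 6.32 on COHOMOLOGY CLASSES of an abstract compact connected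
Kähler manifold, through a multiplicative real de Rham comparison — the tree's discharged hodge.S15
`Motives.hodge_riemann_bilinear_holds` read on `∂̄`-harmonic primitive representatives). This file closes
the chain:

* `HodgeModel.finrank_singularCohomology_carrier_two_mul` — the top cohomology `H^{2d}(X^an; ℂ)` of the
  carrier of a Hodge model of a smooth projective `d`-fold is a line (Poincaré duality on `X(ℂ)`,
  `Motives.ComplexPoints.finrank_singularCohomology_eq_of_add_eq`, `H⁰ ≅ ℂ` for the path-connected
  `X(ℂ)`, transported along the homeomorphism `X^an ≃ₜ X(ℂ)`);
* `HodgeModel.IsKaehlerClassVia.hodgeRiemann_anisotropy` — **the sign-free Hodge–Riemann anisotropy of a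
  Kähler class on the summit carriers**: for `H ∈ H²(X(ℂ); ℂ)` Kähler with respect to a Hodge model `A`
  and a natural multiplicative real de Rham family `e` (`A^* H = e[ω_g] ⊗ 1`), `2m + s = d`, and
  `y ∈ H^{2m}(X(ℂ); ℂ)` RATIONAL of Hodge type `(m,m)` with `L_H^{s+1} y = 0` and `y ≠ 0`:
  `L_Hˢ y ∪ y ≠ 0` in `H^{2d}(X(ℂ); ℂ)`. Proof: read `A^* y = (e ⊗ ℂ) c` with `c ∈ H^{m,m}_dR(X^an)` (all
  models cut out the same `H^{m,m}`, `IsOfHodgeType.mem_hodgePQ`), pull the primitivity back along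
  `A^*` (`lefschetzPow_map`), apply `hodgeRiemann_primitiveClass`:
  `± (Lˢ u ∪ ū) = t · (e[ω^d] ⊗ 1)` with `t > 0` and `[ω^d] ≠ 0` (Voisin I Cor. 3.9,
  `Motives.kaehlerFormPow_deRhamCohomology_mk_ne_zero`), and return through `A^*` (multiplicative,
  `cupProduct_map`; commutes with conjugation, `conjClass_map`; `ȳ = y` for rational `y`,
  `IsRationalClass.conjClass_eq`);
* `hardLefschetz_hodgeRiemann_holds` — **discharge of the named fact `hardLefschetz_hodgeRiemann d X`**
  for every `(d, X)`: the hyperplane-type class of a projective embedding read through the integration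
  de Rham family is Kähler (`HodgeModel.isKaehlerClassVia_of_pullback_eq_fubiniStudyPullbackForm`), so
  the anisotropy hypothesis of `hardLefschetz_hodgeRiemann_of_anisotropy` is the previous theorem.

Consequences already wired in the tree become unconditional: `hodgeClasses_cupPairing_nondegenerate d X`
(BFNP (6.1), `hardLefschetz_hodgeRiemann.hodgeClasses_cupPairing_nondegenerate`) and the route item
`OrthogonalSplit` of `Summits/HodgeConjecture/HodgeConjecture/Theses/EndoscopicMiddleDegree` modulo
"algebraic classes are Hodge classes" (`Theorems/EndoscopicMiddleDegreeOrthogonalSplitOfFacts`).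

What is NOT here: the signs `(-1)ᵐ` (the named fact is sign-free by design: no orientation of
`H^{2d}(X(ℂ); ℂ)` is fixed on the summit carrier); Hodge–Riemann for `(p,q)`-classes with `p ≠ q`
(available at the manifold level in `hodgeRiemann_primitiveClass`, not transported).

## References

* [VoisinHodgeI2002] C. Voisin, Hodge Theory and Complex Algebraic Geometry I (CUP 2002), §3.1.3
  Cor. 3.9, §6.1.3, §6.2.3 Thm. 6.25, Rem. 6.27, Lemma 6.28, §6.3.2 Thm. 6.32, §7.1.2, §7.1.3 Thm. 7.10.
* [Huybrechts2005] D. Huybrechts, Complex Geometry (Springer 2005), Prop. 3.3.15.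
* [HatcherAT2002] A. Hatcher, Algebraic Topology (CUP 2002), §3.1 p. 199, §3.2 Prop. 3.10, §3.3 Cor. 3.37.
* [BrosnanFangNiePearlstein2009] P. Brosnan, H. Fang, Z. Nie, G. Pearlstein, Singularities of admissible
  normal functions, Invent. Math. 177 (2009), §6 (6.1).
-/

noncomputable section

open scoped Manifold ContDiff
open CategoryTheory AlgebraicGeometry Module
open Literature.AlgebraicTopology.SingularHomology Literature.Geometry.Kaehler
open Literature.NumberTheory.Transcendental
open Literature.AlgebraicGeometry.Motives (IsSmoothProjective kaehlerFormPow)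

namespace Literature.AlgebraicGeometry.HodgeTheory

section HodgeTheory

variable {d : ℕ} {X : Motives.SchemeOver ℂ}

/-! ### The top cohomology of the carrier is a line -/

/-- **`H^{2d}(X^an; ℂ)` is a line** for the carrier `X^an = A.carrier` of a Hodge model `A` of a smooth
projective `d`-fold `X`: `dim H^{2d}(X(ℂ); ℂ) = dim H⁰(X(ℂ); ℂ) = 1` (Poincaré duality for the closed
`ℂ`-oriented `2d`-manifold `X(ℂ)`, Hatcher Cor. 3.37 — the tree's
`Motives.ComplexPoints.finrank_singularCohomology_eq_of_add_eq` — and `H⁰ ≅ ℂ` for `X(ℂ)` path connected: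
connected, `connectedSpace_complexPoints`, and locally path connected as a topological manifold), carried
along the homeomorphism `X^an ≃ₜ X(ℂ)` of the analytification (`singularCohomology.mapIso`).
[cite: HatcherAT2002, §3.3 Cor. 3.37 and §3.1 p. 199] -/
theorem HodgeModel.finrank_singularCohomology_carrier_two_mul (A : HodgeModel d X)
    (hX : IsSmoothProjective d X) :
    finrank ℂ (singularCohomology ℂ ℂ A.carrier (2 * d)) = 1 := by
  letI := hX.chartedSpace
  haveI := connectedSpace_complexPoints hX
  haveI : LocallyPathConnectedSpace (Motives.ComplexPoints X) :=
    ChartedSpace.locallyPathConnectedSpace (EuclideanSpace ℝ (Fin (2 * d))) (Motives.ComplexPoints X)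
  haveI : PathConnectedSpace (Motives.ComplexPoints X) := pathConnectedSpace_iff_connectedSpace.mpr ‹_›
  have h1 : finrank ℂ (complexBetti X (2 * d)) = 1 := by
    change finrank ℂ (singularCohomology ℂ ℂ (Motives.ComplexPoints X) (2 * d)) = 1
    rw [Motives.ComplexPoints.finrank_singularCohomology_eq_of_add_eq ℂ hX
      (show 2 * d + 0 = 2 * d by omega),
      (singularCohomologyZeroEquiv ℂ ℂ (Motives.ComplexPoints X)).finrank_eq, Module.finrank_self]
  rw [← h1]
  exact ((singularCohomology.mapIso (R := ℂ) (M := ℂ) A.isAnalytification.homeomorph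
    (2 * d)).toLinearEquiv.finrank_eq).symm

/-! ### The Hodge–Riemann anisotropy of a Kähler class on `H*(X(ℂ); ℂ)` -/

/-- **The sign-free Hodge–Riemann anisotropy of a Kähler class, on the summit carriers** (Voisin I
Thm. 6.32 at `k = 2m`, `p = q = m`: "the form `(-1)^{k(k-1)/2} i^{p-q-k} H_k` is positive definite on
`H^{p,q}_prim`", `H_k(α, β) = iᵏ ∫_X L^{n-k} α ∧ β̄`). Let `X` be smooth projective of dimension `d`, `A` a
Hodge model, `e` a natural and multiplicative real de Rham comparison family over the `A.model`-manifolds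
and `H ∈ H²(X(ℂ); ℂ)` a Kähler class of `(A, e)` (`A^* H = e[ω_g] ⊗ 1` for a Kähler metric `g` on
`X^an`). Then for `2m + s = d` and `y ∈ H^{2m}(X(ℂ); ℂ)` RATIONAL, of Hodge type `(m, m)`, PRIMITIVE
(`L_H^{s+1} y = 0`) and non-zero, `L_Hˢ y ∪ y ≠ 0` in `H^{2d}(X(ℂ); ℂ)` — the printed
`(-1)ᵐ ∫_X L^{d-2m} y ∪ y > 0` rendered sign-free (no orientation `H^{2d}(X(ℂ); ℂ) ≅ ℂ` is fixed on the
carrier; never stronger than print). Proof: `A^* y = (e ⊗ ℂ) c` with `c ∈ H^{m,m}_dR(X^an)`, `c ≠ 0`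
(`IsOfHodgeType.mem_hodgePQ` in the model `A` re-compared through `e ⊗ ℂ`); `L^{s+1}_{A^*H} (A^* y) =
A^*(L_H^{s+1} y) = 0` (`lefschetzPow_map`); `hodgeRiemann_primitiveClass` on the compact connected Kähler
manifold `X^an` (top cohomology a line, `HodgeModel.finrank_singularCohomology_carrier_two_mul`) gives
`i⁰ (-1)^{m(2m-1)} (Lˢ u ∪ ū) = t · (e[ω^d] ⊗ 1)`, `t > 0`, with `[ω^d] ≠ 0` (Voisin I Cor. 3.9); finally
`ū = u` because `ȳ = y` (`IsRationalClass.conjClass_eq`, `conjClass_map`) and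
`Lˢ u ∪ u = A^*(L_Hˢ y ∪ y)` (`cupProduct_map`), `A^*` injective.
[cite: VoisinHodgeI2002, §6.3.2 Thm. 6.32 and §7.1.2] [cite: Huybrechts2005, Prop. 3.3.15] -/
theorem HodgeModel.IsKaehlerClassVia.hodgeRiemann_anisotropy (A : HodgeModel d X)
    {e : DeRhamIsoFamily 𝓘(ℝ, A.model)} (he : e.IsNatural) (hem : e.IsMultiplicative)
    (hX : IsSmoothProjective d X) {H : complexBetti X 2} (hH : A.IsKaehlerClassVia e H)
    (m s : ℕ) (hms : 2 * m + s = d) (y : complexBetti X (2 * m)) (hyQ : IsRationalClass y)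
    (hyT : IsOfHodgeType d X (2 * m) m m y)
    (hprim : lefschetzPowTo H (s + 1) (2 * m) (2 * m + 2 * (s + 1)) rfl y = 0) (hy0 : y ≠ 0) :
    cupProduct (show 2 * m + 2 * s + 2 * m = 2 * d by omega)
      (lefschetzPowTo H s (2 * m) (2 * m + 2 * s) rfl y) y ≠ 0 := by
  obtain ⟨g, hg, hHg⟩ := hH
  -- instances on the carrier
  haveI : Nonempty A.carrier := A.nonempty_carrier hX
  haveI : CompactSpace A.carrier := by
    haveI := Motives.ComplexPoints.compactSpace_of_isSmoothProjective hX
    exact A.isAnalytification.homeomorph.symm.compactSpace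
  haveI : ConnectedSpace A.carrier := A.connectedSpace_carrier hX
  have hdim : finrank ℂ A.model = d := A.isAnalytification.finrank_eq
  -- the class `c ∈ H^{m,m}_dR(X^an)` with `(e ⊗ ℂ) c = A^* y` (all models cut out the same `H^{m,m}`)
  let A' : HodgeModel d X :=
    { A with
      deRham := e.complexify
      deRham_isNatural := DeRhamIsoFamily.complexify_isNatural he }
  have hyA : A'.pullback (2 * m) y ∈ A'.hodgePQ (2 * m) m m := hyT.mem_hodgePQ hX A'
  obtain ⟨c, hc, hcy⟩ := Submodule.mem_map.1 hyA
  have hcy' : complexifyFun e (2 * m) c = A.pullback (2 * m) y := hcy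
  have hc0 : c ≠ 0 := by
    rintro rfl
    apply hy0
    apply A.pullback_injective (2 * m)
    rw [← hcy', map_zero]
    exact (e.complexifyEquiv A.carrier (2 * m)).map_zero
  -- the top cohomology of the carrier is a line
  have htop := A.finrank_singularCohomology_carrier_two_mul hX
  -- the Kähler class pulled back: `A^* H = e[ω_g] ⊗ 1`
  have hκ : singularCohomology.map ℂ ℂ ⟨A.toComplexPoints, A.isAnalytification.isHomeomorph.continuous⟩ 2 H =
      ofRealClass A.carrier 2 (e A.carrier 2 (g.kaehlerClass
        (isSmoothForm_kaehlerForm_of_isManifold_complex_holds (E := A.model) (M := A.carrier)) hg)) := hHg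
  -- primitivity of `u = A^* y = (e ⊗ ℂ) c` with respect to `κ = A^* H`
  have hprim' : lefschetzPow (ofRealClass A.carrier 2 (e A.carrier 2 (g.kaehlerClass
      (isSmoothForm_kaehlerForm_of_isManifold_complex_holds (E := A.model) (M := A.carrier)) hg)))
      (s + 1) (2 * m) (complexifyFun e (2 * m) c) = 0 := by
    rw [hcy', ← hκ]
    change lefschetzPow _ (s + 1) (2 * m) (singularCohomology.map ℂ ℂ _ (2 * m) y) = 0
    rw [← lefschetzPow_map]
    change A.pullback (2 * m + 2 * (s + 1))
      (lefschetzPowTo H (s + 1) (2 * m) (2 * m + 2 * (s + 1)) rfl y) = 0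
    rw [hprim, map_zero]
  -- Hodge–Riemann on the primitive `(m,m)`-class `c` (Voisin I Thm. 6.32 on classes)
  obtain ⟨t, ht, hEq⟩ := hodgeRiemann_primitiveClass (M := A.carrier) hem
    (isSmoothForm_kaehlerForm_of_isManifold_complex_holds (E := A.model) (M := A.carrier)) g hg hdim
    htop (p := m) (q := m) (k := 2 * m) (r := s) (by omega) (by omega) hc hc0 hprim'
  -- the right-hand side `t • (e[ω^d] ⊗ 1)` is non-zero (`[ω^d] ≠ 0`, Voisin I Cor. 3.9)
  have hR : (t : ℂ) • ofRealClass A.carrier (2 * d) (e A.carrier (2 * d)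
      (deRhamCohomology.mk ⟨kaehlerFormPow g.toRiemannianMetric d,
        A.kaehlerFormPow_mem_closedSmoothForms g hg d⟩)) ≠ 0 := by
    refine smul_ne_zero (by exact_mod_cast ht.ne') ?_
    intro h0
    have h1 := ofRealClass_injective (2 * d) (h0.trans (map_zero _).symm)
    rw [LinearEquiv.map_eq_zero_iff] at h1
    exact Motives.kaehlerFormPow_deRhamCohomology_mk_ne_zero g hg (k := d) (by rw [hdim]) _ h1
  rw [← hEq] at hR
  -- hence `Lˢ u ∪ ū ≠ 0` on the carrier
  have hL : cupProduct (show (2 * m + 2 * s) + 2 * m = 2 * d by omega)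
      (lefschetzPow (ofRealClass A.carrier 2 (e A.carrier 2 (g.kaehlerClass
        (isSmoothForm_kaehlerForm_of_isManifold_complex_holds (E := A.model) (M := A.carrier)) hg)))
        s (2 * m) (complexifyFun e (2 * m) c))
      (conjClass A.carrier (2 * m) (complexifyFun e (2 * m) c)) ≠ 0 := by
    intro h0
    apply hR
    rw [h0, smul_zero]
  -- transport back to `X(ℂ)`: `A^*` is multiplicative, natural for `L`, commutes with conjugation,
  -- and `ȳ = y` for the rational class `y`
  intro h0
  apply hL
  rw [hcy', ← hκ]
  change cupProduct _ (lefschetzPow (singularCohomology.map ℂ ℂ _ 2 H) s (2 * m)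
      (singularCohomology.map ℂ ℂ _ (2 * m) y))
    (conjClass A.carrier (2 * m) (singularCohomology.map ℂ ℂ _ (2 * m) y)) = 0
  rw [← lefschetzPow_map, conjClass_map, hyQ.conjClass_eq, ← cupProduct_map]
  change A.pullback (2 * d) (cupProduct _ (lefschetzPowTo H s (2 * m) (2 * m + 2 * s) rfl y) y) = 0
  rw [h0, map_zero]

/-! ### The discharge -/

/-- **The Kähler package of the hyperplane class holds: discharge of the named fact
`hardLefschetz_hodgeRiemann d X`** (file `HardLefschetzHodgeRiemann`), for every `d` and every `X`. For
`X` smooth projective of dimension `d` there is a hard Lefschetz datum `Λ : HardLefschetzNFold d X` — the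
class `r · H`, `r > 0` real, of a hyperplane-type class `H` of a projective embedding `ι : X ⟶ ℙᴺ`
(`A^* H = e[θ_ι] ⊗ 1`, `θ_ι` the restricted Fubini–Study form, `e` the integration de Rham family), made
rational (`exists_pos_smul_isRationalClass_of_pullback_eq_fubiniStudy`), Kähler, supported on and moving
along hyperplane sections (`HyperplaneClassLefschetzOperator`), with hard Lefschetz
(`nonempty_hardLefschetzNFold_holds`) — whose class has the sign-free Hodge–Riemann anisotropy on
rational primitive `(m,m)`-classes: `hardLefschetz_hodgeRiemann_of_anisotropy` fed with
`HodgeModel.IsKaehlerClassVia.hodgeRiemann_anisotropy`, the hyperplane-type class being Kähler for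
`(A, e)` (`HodgeModel.isKaehlerClassVia_of_pullback_eq_fubiniStudyPullbackForm`: `θ_ι` is the Kähler form
of a Kähler metric, Voisin I §3.3.2 Lemma 3.16) and `e` natural and multiplicative
(`integrationDeRhamIsoFamily_isNatural`, `integrationDeRhamIsoFamily_isMultiplicative`, de Rham's theorem,
Warner Thm. 5.36 / 5.45). Voisin I: hard Lefschetz Thm. 6.25 with Rem. 6.27, Hodge–Riemann Thm. 6.32, the
projective case §7.1.2 (i)–(ii) and Thm. 7.10.
[cite: VoisinHodgeI2002, Thm. 6.25, Rem. 6.27, Thm. 6.32, §7.1.2 and Thm. 7.10] -/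
theorem hardLefschetz_hodgeRiemann_holds : hardLefschetz_hodgeRiemann d X :=
  hardLefschetz_hodgeRiemann_of_anisotropy fun hX A _ ι _ hθ _ hH ↦
    (A.isKaehlerClassVia_of_pullback_eq_fubiniStudyPullbackForm (integrationDeRhamIsoFamily A.model)
      hX ι hθ hH).hodgeRiemann_anisotropy A integrationDeRhamIsoFamily_isNatural
      integrationDeRhamIsoFamily_isMultiplicative hX

end HodgeTheory

end Literature.AlgebraicGeometry.HodgeTheory

end
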